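import Mathlib
import HarnessLib
import Summits.HubbardSuperconductivity.HubbardSuperconductivity.Theorems.KLProgrammeC4aPPKernelTrueSigned

/-!
# Route `KLProgramme` — crux C4a, S3 brick (B4) «(B4)-UMK1», «(M1)-TRUE-KERNEL»: the SECOND partner-level derivative `∂ᵤ²N` of the true numerator —
# definition, termwise differentiation, the far bound `|∂ᵤ²N(e,u)| ≤ 3/u²` (`|u| > Λ`) and the uniform bound `≤ (16B₂+24B₁+30)/Λ²`

Cell `gate-hubbard-kl`, seat hubbard-kl-k3c3-p1 (g15; row «δμ-flow with klAngularMean constant piece»).  Continuation of `…C4aPPKernelTrueSigned` (memo `M1-TRUE-KERNEL.md` §7–§8):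
the signed derivative envelope `hK1` of the (U1)-LAWS near the anti-diagonal `u = −e` needs `∂ᵤ²N` (there `∂ᵤ[N/(e+u)] = ψ(u)/(e+u)²`, `ψ(u) = ∂ᵤN·(e+u) − N`,
`ψ(−e) = 0`, `ψ′ = ∂ᵤ²N·(e+u)`).  Contents:
* §1 `hasDerivAt_lorentzian_deriv` (`L″(ω,x) = 2x(x²−3ω²)/(ω²+x²)³`), `abs_lorentzian_deriv2_le` (`≤ 6|x|/(ω²+x²)²`), `abs_lorentzian_deriv2_le_cube` (`≤ 3/ω³`),
  `abs_uvWeightFnD2_le_shell` (`|W″| ≤ ((4B₂+2B₁)/Λ²)·2Λ²/(ω²+Λ²)`);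
* §2 def `ppTrueNumeratorDuu`, `summable_ppD2Dominator`, **`hasDerivAt_ppTrueNumeratorDu_u`** (`∂ᵤ(∂ᵤN) = ppTrueNumeratorDuu`, termwise);
* §3 `ppTrueNumeratorDuu_of_far` (`Λ < |u| ⟹ ∂ᵤ²N = (2/β)Σ W(ωₙ,e)L″(ωₙ,u)`), **`abs_ppTrueNumeratorDuu_far_le`** (`≤ 3/u²`, termwise — no cancellation needed);
* §4 **`abs_ppTrueNumeratorDuu_le_unif`** (`|∂ᵤ²N(e,u)| ≤ (16B₂+24B₁+30)/Λ²` for all `e,u`; shell bookkeeping, `|χ″| ≤ B₂`).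
Pure real analysis; nothing asserts (C), K3 or superconductivity.
References: BGM 2006 §2.4 (2.36) [cite: BenfattoGiulianiMastropietro2006]; Salmhofer 1999 §4.2.5 [cite: Salmhofer1999].
-/

noncomputable section

namespace Summit.HubbardSuperconductivity.HubbardSuperconductivity.Theorems.C4a

set_option linter.dupNamespace false -- summit = problem name (single-conjunct summit), D-0017

open Real Filter Set
open scoped Topology
open Literature.MathematicalPhysics.QuantumLattice Literature.Analysis.SpecialFunctions

/-! ## §1 One-line facts: `L″` and the shell bound for `W″` -/

/-- `d/dx[(ω²−x²)/(ω²+x²)²] = 2x(x²−3ω²)/(ω²+x²)³` (`ω²+x² ≠ 0`). [folklore] -/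
theorem hasDerivAt_lorentzian_deriv (ω : ℝ) {x : ℝ} (h : ω ^ 2 + x ^ 2 ≠ 0) :
    HasDerivAt (fun y : ℝ => (ω ^ 2 - y ^ 2) / (ω ^ 2 + y ^ 2) ^ 2) (2 * x * (x ^ 2 - 3 * ω ^ 2) / (ω ^ 2 + x ^ 2) ^ 3) x := by
  have h1 : HasDerivAt (fun y : ℝ => ω ^ 2 - y ^ 2) (-(2 * x)) x := by
    have h0 := (hasDerivAt_pow 2 x).const_sub (ω ^ 2)
    refine h0.congr_deriv ?_
    simp
  have h2 : HasDerivAt (fun y : ℝ => (ω ^ 2 + y ^ 2) ^ 2) (2 * (ω ^ 2 + x ^ 2) * (2 * x)) x := by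
    have h0 := ((hasDerivAt_pow 2 x).const_add (ω ^ 2)).pow 2
    refine h0.congr_deriv ?_
    simp
  have h := h1.div h2 (pow_ne_zero 2 h)
  refine h.congr_deriv ?_
  field_simp
  ring

/-- `|L″(ω,x)| ≤ 6|x|/(ω²+x²)²`. [folklore] -/
theorem abs_lorentzian_deriv2_le (ω x : ℝ) (h : 0 < ω ^ 2 + x ^ 2) :
    |2 * x * (x ^ 2 - 3 * ω ^ 2) / (ω ^ 2 + x ^ 2) ^ 3| ≤ 6 * |x| / (ω ^ 2 + x ^ 2) ^ 2 := by
  rw [abs_div, abs_of_pos (pow_pos h 3), div_le_div_iff₀ (pow_pos h 3) (pow_pos h 2), abs_mul, abs_mul, abs_of_pos (by norm_num : (0 : ℝ) < 2)]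
  have h1 : |x ^ 2 - 3 * ω ^ 2| ≤ 3 * (ω ^ 2 + x ^ 2) := by
    rw [abs_le]; constructor <;> nlinarith [sq_nonneg x, sq_nonneg ω]
  calc 2 * |x| * |x ^ 2 - 3 * ω ^ 2| * (ω ^ 2 + x ^ 2) ^ 2 ≤ 2 * |x| * (3 * (ω ^ 2 + x ^ 2)) * (ω ^ 2 + x ^ 2) ^ 2 := by gcongr
    _ = 6 * |x| * (ω ^ 2 + x ^ 2) ^ 3 := by ring

/-- `|L″(ω,x)| ≤ 3/ω³` for `ω > 0` (`|x|/(ω²+x²) ≤ 1/(2ω)`, `1/(ω²+x²) ≤ 1/ω²`). [folklore] -/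
theorem abs_lorentzian_deriv2_le_cube {ω : ℝ} (hω : 0 < ω) (x : ℝ) : |2 * x * (x ^ 2 - 3 * ω ^ 2) / (ω ^ 2 + x ^ 2) ^ 3| ≤ 3 / ω ^ 3 := by
  have h : 0 < ω ^ 2 + x ^ 2 := by positivity
  refine (abs_lorentzian_deriv2_le ω x h).trans ?_
  have h1 := abs_lorentzian_le_half_inv hω x
  rw [abs_div, abs_of_pos h] at h1
  have h2 : 1 / (ω ^ 2 + x ^ 2) ≤ 1 / ω ^ 2 := one_div_le_one_div_of_le (by positivity) (by nlinarith [sq_nonneg x])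
  calc 6 * |x| / (ω ^ 2 + x ^ 2) ^ 2 = 6 * (|x| / (ω ^ 2 + x ^ 2)) * (1 / (ω ^ 2 + x ^ 2)) := by field_simp
    _ ≤ 6 * (1 / (2 * ω)) * (1 / ω ^ 2) := by gcongr
    _ = 3 / ω ^ 3 := by field_simp; ring

/-- **Shell bound for `W″`**: `|W″(ω,x)| ≤ ((4B₂+2B₁)/Λ²)·(2Λ²/(ω²+Λ²))` (zero above the shell, where `ω² ≤ Λ²` fails the factor is `≥ 1`).
[cite: Salmhofer1999, §4.2.5 (4.71)] -/
theorem abs_uvWeightFnD2_le_shell {B₁ B₂ : ℝ} (hB₁ : ∀ x, |deriv salmhoferCutoff x| ≤ B₁) (hB₂ : ∀ x, |deriv (deriv salmhoferCutoff) x| ≤ B₂) {Λ : ℝ}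
    (hΛ : 0 < Λ) (ω x : ℝ) : |uvWeightFnD2 Λ ω x| ≤ (4 * B₂ + 2 * B₁) / Λ ^ 2 * (2 * Λ ^ 2 / (ω ^ 2 + Λ ^ 2)) := by
  have hB0 := salmhoferB₁_nonneg hB₁
  have hB20 : 0 ≤ B₂ := (abs_nonneg _).trans (hB₂ 0)
  by_cases h : Λ ^ 2 < x ^ 2 + ω ^ 2
  · rw [(uvWeightFn_eq_one_of_gt hΛ h).2.2, abs_zero]; positivity
  · have hωΛ : ω ^ 2 ≤ Λ ^ 2 := by nlinarith [not_lt.1 h, sq_nonneg x]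
    have h1 := abs_uvWeightFnD2_le hB₁ hB₂ hΛ ω x
    have h2 : 1 ≤ 2 * Λ ^ 2 / (ω ^ 2 + Λ ^ 2) := by rw [le_div_iff₀ (by positivity)]; nlinarith
    calc |uvWeightFnD2 Λ ω x| ≤ (4 * B₂ + 2 * B₁) / Λ ^ 2 * 1 := by rw [mul_one]; exact h1
      _ ≤ (4 * B₂ + 2 * B₁) / Λ ^ 2 * (2 * Λ ^ 2 / (ω ^ 2 + Λ ^ 2)) := mul_le_mul_of_nonneg_left h2 (by positivity)

/-! ## §2 The second derivative series -/

/-- `∂ᵤ²N(e,u) = (2/β)Σ W(ωₙ,e)[W″(ωₙ,u)(L_e+L_u) + 2W′(ωₙ,u)L′(ωₙ,u) + W(ωₙ,u)L″(ωₙ,u)]`. -/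
def ppTrueNumeratorDuu (β Λ e u : ℝ) : ℝ :=
  2 / β * ∑' n : ℕ, uvWeightFn Λ (ppFreq β n) e *
    (uvWeightFnD2 Λ (ppFreq β n) u * (e / (ppFreq β n ^ 2 + e ^ 2) + u / (ppFreq β n ^ 2 + u ^ 2)) +
      2 * uvWeightFnD1 Λ (ppFreq β n) u * ((ppFreq β n ^ 2 - u ^ 2) / (ppFreq β n ^ 2 + u ^ 2) ^ 2) +
      uvWeightFn Λ (ppFreq β n) u * (2 * u * (u ^ 2 - 3 * ppFreq β n ^ 2) / (ppFreq β n ^ 2 + u ^ 2) ^ 3))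

/-- `1/ωₙ ≤ β/π`. [folklore] -/
theorem inv_ppFreq_le {β : ℝ} (hβ : 0 < β) (n : ℕ) : 1 / ppFreq β n ≤ β / π := by
  rw [div_le_div_iff₀ (ppFreq_pos hβ n) Real.pi_pos, one_mul]
  have := pi_div_le_ppFreq hβ n
  rw [div_le_iff₀ hβ] at this
  linarith

/-- The dominator of the second-derivative series is summable. [folklore] -/
theorem summable_ppD2Dominator {β Λ : ℝ} (hβ : 0 < β) (a b c : ℝ) :
    Summable fun n : ℕ => a * (2 * Λ ^ 2 / (ppFreq β n ^ 2 + Λ ^ 2)) + b * (2 * Λ ^ 2 / (ppFreq β n ^ 2 + Λ ^ 2)) + c * (1 / (ppFreq β n ^ 2 + 0 ^ 2)) := by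
  have hs := summable_one_div_ppFreq_sq_add_sq hβ Λ
  refine Summable.add (Summable.add ?_ ?_) ((summable_one_div_ppFreq_sq_add_sq hβ 0).mul_left c)
  · exact (hs.mul_left (a * (2 * Λ ^ 2))).congr fun n => by field_simp
  · exact (hs.mul_left (b * (2 * Λ ^ 2))).congr fun n => by field_simp

/-- **`∂ᵤ(∂ᵤN) = ppTrueNumeratorDuu`** everywhere (termwise differentiation; `|χ′| ≤ B₁`, `|χ″| ≤ B₂`). [cite: BenfattoGiulianiMastropietro2006, §2.4 (2.36)] -/
theorem hasDerivAt_ppTrueNumeratorDu_u {β Λ : ℝ} (hβ : 0 < β) (hΛ : 0 < Λ) {B₁ B₂ : ℝ} (hB₁ : ∀ x, |deriv salmhoferCutoff x| ≤ B₁)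
    (hB₂ : ∀ x, |deriv (deriv salmhoferCutoff) x| ≤ B₂) (e u : ℝ) :
    HasDerivAt (fun v => ppTrueNumeratorDu β Λ e v) (ppTrueNumeratorDuu β Λ e u) u := by
  have hB0 := salmhoferB₁_nonneg hB₁
  have hB20 : 0 ≤ B₂ := (abs_nonneg _).trans (hB₂ 0)
  have hω : ∀ n : ℕ, 0 < ppFreq β n := ppFreq_pos hβ
  have hωπ := inv_ppFreq_le hβ
  unfold ppTrueNumeratorDu ppTrueNumeratorDuu
  refine HasDerivAt.const_mul (2 / β) ?_
  -- uniform majorants: `|L_e| ≤ |e|(β/π)²`, `|L_v| ≤ β/π`, `|L′| ≤ (β/π)²`, `|L″| ≤ 3(β/π)·1/ωₙ²`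
  have hLe : ∀ n : ℕ, |e / (ppFreq β n ^ 2 + e ^ 2)| ≤ |e| * (β / π) ^ 2 := fun n => by
    refine (abs_lorentzian_le_abs_div_sq (hω n).ne' e).trans ?_
    rw [div_eq_mul_one_div]
    refine mul_le_mul_of_nonneg_left ?_ (abs_nonneg e)
    calc 1 / ppFreq β n ^ 2 = (1 / ppFreq β n) ^ 2 := by rw [one_div_pow]
      _ ≤ (β / π) ^ 2 := pow_le_pow_left₀ (by have := hω n; positivity) (hωπ n) 2
  have hLv : ∀ (n : ℕ) (v : ℝ), |v / (ppFreq β n ^ 2 + v ^ 2)| ≤ β / π := fun n v =>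
    (abs_lorentzian_le_half_inv (hω n) v).trans (by
      calc 1 / (2 * ppFreq β n) = (1 / ppFreq β n) / 2 := by field_simp
        _ ≤ (β / π) / 2 := by have := hωπ n; linarith
        _ ≤ β / π := by linarith [show 0 < β / π by positivity])
  have hL1 : ∀ (n : ℕ) (v : ℝ), |(ppFreq β n ^ 2 - v ^ 2) / (ppFreq β n ^ 2 + v ^ 2) ^ 2| ≤ (β / π) ^ 2 := fun n v => by
    refine (abs_lorentzian_deriv_le_inv (by have := hω n; positivity)).trans ?_
    calc 1 / (ppFreq β n ^ 2 + v ^ 2) ≤ 1 / ppFreq β n ^ 2 := one_div_le_one_div_of_le (pow_pos (hω n) 2) (by nlinarith [sq_nonneg v])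
      _ = (1 / ppFreq β n) ^ 2 := by rw [one_div_pow]
      _ ≤ (β / π) ^ 2 := pow_le_pow_left₀ (by have := hω n; positivity) (hωπ n) 2
  have hL2 : ∀ (n : ℕ) (v : ℝ), |2 * v * (v ^ 2 - 3 * ppFreq β n ^ 2) / (ppFreq β n ^ 2 + v ^ 2) ^ 3| ≤ 3 * (β / π) * (1 / (ppFreq β n ^ 2 + 0 ^ 2)) :=
    fun n v => by
      refine (abs_lorentzian_deriv2_le_cube (hω n) v).trans ?_
      rw [zero_pow two_ne_zero, add_zero]
      have h0 : 0 ≤ 1 / ppFreq β n ^ 2 := by have := hω n; positivity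
      calc 3 / ppFreq β n ^ 3 = 3 * (1 / ppFreq β n) * (1 / ppFreq β n ^ 2) := by field_simp
        _ ≤ 3 * (β / π) * (1 / ppFreq β n ^ 2) := mul_le_mul_of_nonneg_right (mul_le_mul_of_nonneg_left (hωπ n) (by norm_num)) h0
  set a : ℝ := (4 * B₂ + 2 * B₁) / Λ ^ 2 * (|e| * (β / π) ^ 2 + β / π) with ha
  set b : ℝ := 2 * (2 * B₁ / Λ) * (β / π) ^ 2 with hb
  set c : ℝ := 3 * (β / π) with hc
  refine hasDerivAt_tsum (u := fun n : ℕ => a * (2 * Λ ^ 2 / (ppFreq β n ^ 2 + Λ ^ 2)) + b * (2 * Λ ^ 2 / (ppFreq β n ^ 2 + Λ ^ 2)) +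
      c * (1 / (ppFreq β n ^ 2 + 0 ^ 2)))
    (g := fun (n : ℕ) (v : ℝ) => uvWeightFn Λ (ppFreq β n) e *
      (uvWeightFnD1 Λ (ppFreq β n) v * (e / (ppFreq β n ^ 2 + e ^ 2) + v / (ppFreq β n ^ 2 + v ^ 2)) +
        uvWeightFn Λ (ppFreq β n) v * ((ppFreq β n ^ 2 - v ^ 2) / (ppFreq β n ^ 2 + v ^ 2) ^ 2)))
    (g' := fun (n : ℕ) (v : ℝ) => uvWeightFn Λ (ppFreq β n) e *
      (uvWeightFnD2 Λ (ppFreq β n) v * (e / (ppFreq β n ^ 2 + e ^ 2) + v / (ppFreq β n ^ 2 + v ^ 2)) +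
        2 * uvWeightFnD1 Λ (ppFreq β n) v * ((ppFreq β n ^ 2 - v ^ 2) / (ppFreq β n ^ 2 + v ^ 2) ^ 2) +
        uvWeightFn Λ (ppFreq β n) v * (2 * v * (v ^ 2 - 3 * ppFreq β n ^ 2) / (ppFreq β n ^ 2 + v ^ 2) ^ 3)))
    (summable_ppD2Dominator hβ a b c) (fun n v => ?_) (fun n v => ?_) (y₀ := u) ?_ u
  · -- termwise derivative
    have hne : ppFreq β n ^ 2 + v ^ 2 ≠ 0 := by have := hω n; positivity
    have hW : HasDerivAt (fun y => uvWeightFn Λ (ppFreq β n) y) (uvWeightFnD1 Λ (ppFreq β n) v) v := hasDerivAt_uvWeightFn Λ (ppFreq β n) v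
    have hW1 : HasDerivAt (fun y => uvWeightFnD1 Λ (ppFreq β n) y) (uvWeightFnD2 Λ (ppFreq β n) v) v := hasDerivAt_uvWeightFnD1 Λ (ppFreq β n) v
    have hL : HasDerivAt (fun y : ℝ => y / (ppFreq β n ^ 2 + y ^ 2)) ((ppFreq β n ^ 2 - v ^ 2) / (ppFreq β n ^ 2 + v ^ 2) ^ 2) v :=
      hasDerivAt_lorentzian (ppFreq β n) hne
    have hL' := hasDerivAt_lorentzian_deriv (ppFreq β n) hne
    have h := ((hW1.fun_mul (hL.const_add (e / (ppFreq β n ^ 2 + e ^ 2)))).fun_add (hW.fun_mul hL')).const_mul (uvWeightFn Λ (ppFreq β n) e)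
    refine (h.congr_of_eventuallyEq (Eventually.of_forall fun y => by ring)).congr_deriv ?_
    ring
  · -- the dominator
    have hWe : |uvWeightFn Λ (ppFreq β n) e| ≤ 1 := abs_uvWeightFn_le_one _ _ _
    have hWv : |uvWeightFn Λ (ppFreq β n) v| ≤ 1 := abs_uvWeightFn_le_one _ _ _
    have hD1 := abs_uvWeightFnD1_le_shell hB₁ hΛ (ppFreq β n) v
    have hD2 := abs_uvWeightFnD2_le_shell hB₁ hB₂ hΛ (ppFreq β n) v
    rw [Real.norm_eq_abs, abs_mul]
    have hsum : |e / (ppFreq β n ^ 2 + e ^ 2) + v / (ppFreq β n ^ 2 + v ^ 2)| ≤ |e| * (β / π) ^ 2 + β / π :=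
      (abs_add_le _ _).trans (add_le_add (hLe n) (hLv n v))
    have hp1 : |uvWeightFnD2 Λ (ppFreq β n) v * (e / (ppFreq β n ^ 2 + e ^ 2) + v / (ppFreq β n ^ 2 + v ^ 2))| ≤
        (4 * B₂ + 2 * B₁) / Λ ^ 2 * (2 * Λ ^ 2 / (ppFreq β n ^ 2 + Λ ^ 2)) * (|e| * (β / π) ^ 2 + β / π) := by
      rw [abs_mul]; exact mul_le_mul hD2 hsum (abs_nonneg _) (by positivity)
    have hp2 : |2 * uvWeightFnD1 Λ (ppFreq β n) v * ((ppFreq β n ^ 2 - v ^ 2) / (ppFreq β n ^ 2 + v ^ 2) ^ 2)| ≤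
        2 * (2 * B₁ / Λ * (2 * Λ ^ 2 / (ppFreq β n ^ 2 + Λ ^ 2))) * (β / π) ^ 2 := by
      rw [abs_mul, abs_mul, abs_of_pos (by norm_num : (0 : ℝ) < 2)]
      exact mul_le_mul (mul_le_mul_of_nonneg_left hD1 (by norm_num)) (hL1 n v) (abs_nonneg _) (by positivity)
    have hp3 : |uvWeightFn Λ (ppFreq β n) v * (2 * v * (v ^ 2 - 3 * ppFreq β n ^ 2) / (ppFreq β n ^ 2 + v ^ 2) ^ 3)| ≤
        1 * (3 * (β / π) * (1 / (ppFreq β n ^ 2 + 0 ^ 2))) := by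
      rw [abs_mul]; exact mul_le_mul hWv (hL2 n v) (abs_nonneg _) zero_le_one
    calc |uvWeightFn Λ (ppFreq β n) e| * |uvWeightFnD2 Λ (ppFreq β n) v * (e / (ppFreq β n ^ 2 + e ^ 2) + v / (ppFreq β n ^ 2 + v ^ 2)) +
          2 * uvWeightFnD1 Λ (ppFreq β n) v * ((ppFreq β n ^ 2 - v ^ 2) / (ppFreq β n ^ 2 + v ^ 2) ^ 2) +
          uvWeightFn Λ (ppFreq β n) v * (2 * v * (v ^ 2 - 3 * ppFreq β n ^ 2) / (ppFreq β n ^ 2 + v ^ 2) ^ 3)|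
        ≤ 1 * ((4 * B₂ + 2 * B₁) / Λ ^ 2 * (2 * Λ ^ 2 / (ppFreq β n ^ 2 + Λ ^ 2)) * (|e| * (β / π) ^ 2 + β / π) +
            2 * (2 * B₁ / Λ * (2 * Λ ^ 2 / (ppFreq β n ^ 2 + Λ ^ 2))) * (β / π) ^ 2 + 1 * (3 * (β / π) * (1 / (ppFreq β n ^ 2 + 0 ^ 2)))) :=
          mul_le_mul hWe ((abs_add_le _ _).trans (add_le_add ((abs_add_le _ _).trans (add_le_add hp1 hp2)) hp3)) (abs_nonneg _) zero_le_one
      _ = a * (2 * Λ ^ 2 / (ppFreq β n ^ 2 + Λ ^ 2)) + b * (2 * Λ ^ 2 / (ppFreq β n ^ 2 + Λ ^ 2)) + c * (1 / (ppFreq β n ^ 2 + 0 ^ 2)) := by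
          rw [ha, hb, hc]; ring
  · -- summability of the first-derivative series at `u`
    exact Summable.of_norm_bounded (summable_ppDominator hβ B₁ (β / π)) fun n => by
      rw [Real.norm_eq_abs]; exact abs_ppDuSummand_le hβ hΛ hB₁ n e u

/-! ## §3 The far region -/

/-- **`Λ < |u| ⟹ ∂ᵤ²N(e,u) = (2/β)Σ W(ωₙ,e)·L″(ωₙ,u)`** (the partner weight is `1`, its derivatives vanish). [cite: BenfattoGiulianiMastropietro2006, §2.4 (2.36)] -/
theorem ppTrueNumeratorDuu_of_far {β Λ u : ℝ} (hΛ : 0 < Λ) (hu : Λ < |u|) (e : ℝ) :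
    ppTrueNumeratorDuu β Λ e u = 2 / β * ∑' n : ℕ, uvWeightFn Λ (ppFreq β n) e * (2 * u * (u ^ 2 - 3 * ppFreq β n ^ 2) / (ppFreq β n ^ 2 + u ^ 2) ^ 3) := by
  unfold ppTrueNumeratorDuu
  congr 1
  refine tsum_congr fun n => ?_
  have h : Λ ^ 2 < u ^ 2 + ppFreq β n ^ 2 := by
    have hu0 : 0 ≤ Λ := hΛ.le
    have : Λ ^ 2 < |u| ^ 2 := by nlinarith
    rw [sq_abs] at this
    nlinarith [sq_nonneg (ppFreq β n)]
  obtain ⟨h0, h1, h2⟩ := uvWeightFn_eq_one_of_gt hΛ h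
  rw [h0, h1, h2]; ring

/-- **`Λ < |u| ⟹ |∂ᵤ²N(e,u)| ≤ 3/u²`** (termwise `|L″| ≤ 6|u|/(ωₙ²+u²)² ≤ (6/|u|)·1/(ωₙ²+u²)`, `(2/β)Σ1/(ωₙ²+u²) = tanh(β|u|/2)/(2|u|)`).
[cite: BenfattoGiulianiMastropietro2006, §2.4 (2.36)] -/
theorem abs_ppTrueNumeratorDuu_far_le {β Λ u : ℝ} (hβ : 0 < β) (hΛ : 0 < Λ) (hu : Λ < |u|) (e : ℝ) : |ppTrueNumeratorDuu β Λ e u| ≤ 3 / u ^ 2 := by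
  have hu0 : 0 < |u| := hΛ.trans hu
  have hune : u ≠ 0 := abs_pos.1 hu0
  have hω : ∀ n : ℕ, 0 < ppFreq β n := ppFreq_pos hβ
  rw [ppTrueNumeratorDuu_of_far hΛ hu e, abs_mul, abs_of_pos (by positivity : (0 : ℝ) < 2 / β)]
  set g : ℕ → ℝ := fun n => 6 / |u| * (1 / (ppFreq β n ^ 2 + |u| ^ 2)) with hg
  have hbd : ∀ n : ℕ, ‖uvWeightFn Λ (ppFreq β n) e * (2 * u * (u ^ 2 - 3 * ppFreq β n ^ 2) / (ppFreq β n ^ 2 + u ^ 2) ^ 3)‖ ≤ g n := fun n => by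
    have hq : 0 < ppFreq β n ^ 2 + u ^ 2 := by positivity
    rw [Real.norm_eq_abs, abs_mul]
    have h1 := abs_lorentzian_deriv2_le (ppFreq β n) u hq
    have h2 : 6 * |u| / (ppFreq β n ^ 2 + u ^ 2) ^ 2 ≤ g n := by
      have hg' : g n = 6 / (|u| * (ppFreq β n ^ 2 + u ^ 2)) := by simp only [hg]; rw [sq_abs]; field_simp
      rw [hg', div_le_div_iff₀ (pow_pos hq 2) (by positivity)]
      have hu2 : |u| * |u| = u ^ 2 := by rw [← sq, sq_abs]
      have hle : u ^ 2 ≤ ppFreq β n ^ 2 + u ^ 2 := by nlinarith [sq_nonneg (ppFreq β n)]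
      calc 6 * |u| * (|u| * (ppFreq β n ^ 2 + u ^ 2)) = 6 * (|u| * |u|) * (ppFreq β n ^ 2 + u ^ 2) := by ring
        _ = 6 * u ^ 2 * (ppFreq β n ^ 2 + u ^ 2) := by rw [hu2]
        _ ≤ 6 * (ppFreq β n ^ 2 + u ^ 2) * (ppFreq β n ^ 2 + u ^ 2) := by gcongr
        _ = 6 * (ppFreq β n ^ 2 + u ^ 2) ^ 2 := by ring
    calc |uvWeightFn Λ (ppFreq β n) e| * |2 * u * (u ^ 2 - 3 * ppFreq β n ^ 2) / (ppFreq β n ^ 2 + u ^ 2) ^ 3| ≤ 1 * (6 * |u| / (ppFreq β n ^ 2 + u ^ 2) ^ 2) :=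
          mul_le_mul (abs_uvWeightFn_le_one _ _ _) h1 (abs_nonneg _) zero_le_one
      _ ≤ g n := by rw [one_mul]; exact h2
  have hsg : Summable g := (summable_one_div_ppFreq_sq_add_sq hβ |u|).mul_left _
  have hgsum : ∑' n, g n = 6 / |u| * (β * Real.tanh (β * |u| / 2) / (4 * |u|)) := by
    simp only [hg]; rw [tsum_mul_left, tsum_one_div_ppFreq_sq_add_sq hβ hu0.ne']
  have ht := tsum_of_norm_bounded hsg.hasSum hbd
  rw [Real.norm_eq_abs, hgsum] at ht
  have htanh : Real.tanh (β * |u| / 2) ≤ 1 := (Real.tanh_lt_one _).le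
  calc 2 / β * |∑' n : ℕ, uvWeightFn Λ (ppFreq β n) e * (2 * u * (u ^ 2 - 3 * ppFreq β n ^ 2) / (ppFreq β n ^ 2 + u ^ 2) ^ 3)|
      ≤ 2 / β * (6 / |u| * (β * Real.tanh (β * |u| / 2) / (4 * |u|))) := mul_le_mul_of_nonneg_left ht (by positivity)
    _ = 3 / |u| ^ 2 * Real.tanh (β * |u| / 2) := by field_simp; ring
    _ ≤ 3 / |u| ^ 2 * 1 := mul_le_mul_of_nonneg_left htanh (by positivity)
    _ = 3 / u ^ 2 := by rw [mul_one, sq_abs]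

/-! ## §4 The uniform bound -/

/-- On the shell `Λ²/4 ≤ ω²+x²`: `|x|/(ω²+x²) ≤ 2/Λ`. [folklore] -/
theorem abs_lorentzian_le_of_shell {Λ ω x : ℝ} (hΛ : 0 < Λ) (hs : Λ ^ 2 / 4 ≤ x ^ 2 + ω ^ 2) : |x / (ω ^ 2 + x ^ 2)| ≤ 2 / Λ := by
  have hΛ4 : 0 < Λ ^ 2 / 4 := by positivity
  have hq : 0 < ω ^ 2 + x ^ 2 := by linarith
  rw [abs_div, abs_of_pos hq, div_le_div_iff₀ hq hΛ]
  rcases le_or_gt (Λ / 2) |x| with h | h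
  · nlinarith [sq_abs x, abs_nonneg x, sq_nonneg ω]
  · nlinarith [sq_abs x, abs_nonneg x]

/-- **THE UNIFORM BOUND `|∂ᵤ²N(e,u)| ≤ (16B₂ + 24B₁ + 30)/Λ²`** for all levels (`|χ′| ≤ B₁`, `|χ″| ≤ B₂`): per frequency the four shell terms are
`≤ (32B₂ + 48B₁ + 60)/(Λ(ωₙ²+Λ²))`, and `(2/β)Σ 1/(ωₙ²+Λ²) ≤ 1/(2Λ)`. [cite: BenfattoGiulianiMastropietro2006, §2.4 (2.36)] -/
theorem abs_ppTrueNumeratorDuu_le_unif {β Λ : ℝ} (hβ : 0 < β) (hΛ : 0 < Λ) {B₁ B₂ : ℝ} (hB₁ : ∀ x, |deriv salmhoferCutoff x| ≤ B₁)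
    (hB₂ : ∀ x, |deriv (deriv salmhoferCutoff) x| ≤ B₂) (e u : ℝ) : |ppTrueNumeratorDuu β Λ e u| ≤ (16 * B₂ + 24 * B₁ + 30) / Λ ^ 2 := by
  have hB0 := salmhoferB₁_nonneg hB₁
  have hB20 : 0 ≤ B₂ := (abs_nonneg _).trans (hB₂ 0)
  have hω : ∀ n : ℕ, 0 < ppFreq β n := ppFreq_pos hβ
  unfold ppTrueNumeratorDuu
  set C : ℝ := (32 * B₂ + 48 * B₁ + 60) / Λ with hC
  set g : ℕ → ℝ := fun n => C * (1 / (ppFreq β n ^ 2 + Λ ^ 2)) with hg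
  have hbd : ∀ n : ℕ, ‖uvWeightFn Λ (ppFreq β n) e *
      (uvWeightFnD2 Λ (ppFreq β n) u * (e / (ppFreq β n ^ 2 + e ^ 2) + u / (ppFreq β n ^ 2 + u ^ 2)) +
        2 * uvWeightFnD1 Λ (ppFreq β n) u * ((ppFreq β n ^ 2 - u ^ 2) / (ppFreq β n ^ 2 + u ^ 2) ^ 2) +
        uvWeightFn Λ (ppFreq β n) u * (2 * u * (u ^ 2 - 3 * ppFreq β n ^ 2) / (ppFreq β n ^ 2 + u ^ 2) ^ 3))‖ ≤ g n := fun n => by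
    set ω := ppFreq β n with hωdef
    have hω0 : 0 < ω := hω n
    have hq : 0 < ω ^ 2 + u ^ 2 := by positivity
    have hZ : 0 < ω ^ 2 + Λ ^ 2 := by positivity
    have hWe : |uvWeightFn Λ ω e| ≤ 1 := abs_uvWeightFn_le_one _ _ _
    have hD2 := abs_uvWeightFnD2_le_shell hB₁ hB₂ hΛ ω u
    have hD1 := abs_uvWeightFnD1_le_shell hB₁ hΛ ω u
    -- (a) `|W_e·W″(u)·L_e| ≤ |W″|·2/Λ`
    have hWL : |uvWeightFn Λ ω e * (e / (ω ^ 2 + e ^ 2))| ≤ 2 / Λ := abs_uvWeightFn_mul_lorentzian_le hΛ ω e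
    have ha : |uvWeightFn Λ ω e * (uvWeightFnD2 Λ ω u * (e / (ω ^ 2 + e ^ 2)))| ≤ (4 * B₂ + 2 * B₁) / Λ ^ 2 * (2 * Λ ^ 2 / (ω ^ 2 + Λ ^ 2)) * (2 / Λ) := by
      rw [show uvWeightFn Λ ω e * (uvWeightFnD2 Λ ω u * (e / (ω ^ 2 + e ^ 2))) = uvWeightFnD2 Λ ω u * (uvWeightFn Λ ω e * (e / (ω ^ 2 + e ^ 2))) by ring,
        abs_mul]
      exact mul_le_mul hD2 hWL (abs_nonneg _) (by positivity)
    -- (b) `|W_e·W″(u)·L_u| ≤ |W″|·2/Λ` (on the shell `|L_u| ≤ 2/Λ`; off it `W″ = 0`)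
    have hb : |uvWeightFn Λ ω e * (uvWeightFnD2 Λ ω u * (u / (ω ^ 2 + u ^ 2)))| ≤ (4 * B₂ + 2 * B₁) / Λ ^ 2 * (2 * Λ ^ 2 / (ω ^ 2 + Λ ^ 2)) * (2 / Λ) := by
      by_cases hlow : u ^ 2 + ω ^ 2 < Λ ^ 2 / 4
      · rw [(uvWeightFn_eq_zero_of_lt hΛ hlow).2.2]; simp; positivity
      · have hs : Λ ^ 2 / 4 ≤ u ^ 2 + ω ^ 2 := not_lt.1 hlow
        have hLu := abs_lorentzian_le_of_shell hΛ hs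
        rw [abs_mul, abs_mul]
        calc |uvWeightFn Λ ω e| * (|uvWeightFnD2 Λ ω u| * |u / (ω ^ 2 + u ^ 2)|) ≤ 1 * ((4 * B₂ + 2 * B₁) / Λ ^ 2 * (2 * Λ ^ 2 / (ω ^ 2 + Λ ^ 2)) * (2 / Λ)) :=
              mul_le_mul hWe (mul_le_mul hD2 hLu (abs_nonneg _) (by positivity)) (by positivity) zero_le_one
          _ = _ := one_mul _
    -- (c) `|W_e·2W′(u)·L′(u)| ≤ 2|W′|·4/Λ²` (on the shell `|L′| ≤ 1/(ω²+u²) ≤ 4/Λ²`)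
    have hc : |uvWeightFn Λ ω e * (2 * uvWeightFnD1 Λ ω u * ((ω ^ 2 - u ^ 2) / (ω ^ 2 + u ^ 2) ^ 2))| ≤
        2 * (2 * B₁ / Λ * (2 * Λ ^ 2 / (ω ^ 2 + Λ ^ 2))) * (4 / Λ ^ 2) := by
      by_cases hlow : u ^ 2 + ω ^ 2 < Λ ^ 2 / 4
      · rw [(uvWeightFn_eq_zero_of_lt hΛ hlow).2.1]; simp; positivity
      · have hs : Λ ^ 2 / 4 ≤ ω ^ 2 + u ^ 2 := by linarith [not_lt.1 hlow]
        have hL1 : |(ω ^ 2 - u ^ 2) / (ω ^ 2 + u ^ 2) ^ 2| ≤ 4 / Λ ^ 2 :=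
          (abs_lorentzian_deriv_le_inv hq).trans (by rw [div_le_div_iff₀ hq (by positivity)]; nlinarith)
        rw [abs_mul, abs_mul, abs_mul, abs_of_pos (by norm_num : (0 : ℝ) < 2)]
        calc |uvWeightFn Λ ω e| * (2 * |uvWeightFnD1 Λ ω u| * |(ω ^ 2 - u ^ 2) / (ω ^ 2 + u ^ 2) ^ 2|) ≤
            1 * (2 * (2 * B₁ / Λ * (2 * Λ ^ 2 / (ω ^ 2 + Λ ^ 2))) * (4 / Λ ^ 2)) :=
              mul_le_mul hWe (mul_le_mul (mul_le_mul_of_nonneg_left hD1 (by norm_num)) hL1 (abs_nonneg _) (by positivity)) (by positivity) zero_le_one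
          _ = _ := one_mul _
    -- (d) `|W_e·W(u)·L″(u)| ≤ 60/(Λ(ω²+Λ²))` (on the shell `|L″| ≤ (12/Λ)·1/(ω²+u²)`, `1/(ω²+u²) ≤ 5/(ω²+Λ²)`)
    have hd : |uvWeightFn Λ ω e * (uvWeightFn Λ ω u * (2 * u * (u ^ 2 - 3 * ω ^ 2) / (ω ^ 2 + u ^ 2) ^ 3))| ≤ 60 / Λ * (1 / (ω ^ 2 + Λ ^ 2)) := by
      by_cases hW : uvWeightFn Λ ω u = 0
      · rw [hW]; simp; positivity
      · have hs : Λ ^ 2 / 4 ≤ u ^ 2 + ω ^ 2 := sq_add_sq_ge_of_uvWeightFn_ne_zero hΛ hW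
        have hLu := abs_lorentzian_le_of_shell hΛ hs
        rw [abs_div, abs_of_pos hq] at hLu
        have h5 : 1 / (ω ^ 2 + u ^ 2) ≤ 5 / (ω ^ 2 + Λ ^ 2) := by rw [div_le_div_iff₀ hq hZ]; nlinarith
        have hL2 : |2 * u * (u ^ 2 - 3 * ω ^ 2) / (ω ^ 2 + u ^ 2) ^ 3| ≤ 60 / Λ * (1 / (ω ^ 2 + Λ ^ 2)) := by
          refine (abs_lorentzian_deriv2_le ω u hq).trans ?_
          calc 6 * |u| / (ω ^ 2 + u ^ 2) ^ 2 = 6 * (|u| / (ω ^ 2 + u ^ 2)) * (1 / (ω ^ 2 + u ^ 2)) := by field_simp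
            _ ≤ 6 * (2 / Λ) * (5 / (ω ^ 2 + Λ ^ 2)) := by gcongr
            _ = 60 / Λ * (1 / (ω ^ 2 + Λ ^ 2)) := by ring
        rw [abs_mul, abs_mul]
        calc |uvWeightFn Λ ω e| * (|uvWeightFn Λ ω u| * |2 * u * (u ^ 2 - 3 * ω ^ 2) / (ω ^ 2 + u ^ 2) ^ 3|) ≤ 1 * (1 * (60 / Λ * (1 / (ω ^ 2 + Λ ^ 2)))) :=
              mul_le_mul hWe (mul_le_mul (abs_uvWeightFn_le_one _ _ _) hL2 (abs_nonneg _) zero_le_one) (by positivity) zero_le_one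
          _ = _ := by ring
    -- assemble
    have hsplit : uvWeightFn Λ ω e *
        (uvWeightFnD2 Λ ω u * (e / (ω ^ 2 + e ^ 2) + u / (ω ^ 2 + u ^ 2)) + 2 * uvWeightFnD1 Λ ω u * ((ω ^ 2 - u ^ 2) / (ω ^ 2 + u ^ 2) ^ 2) +
          uvWeightFn Λ ω u * (2 * u * (u ^ 2 - 3 * ω ^ 2) / (ω ^ 2 + u ^ 2) ^ 3)) =
        uvWeightFn Λ ω e * (uvWeightFnD2 Λ ω u * (e / (ω ^ 2 + e ^ 2))) + uvWeightFn Λ ω e * (uvWeightFnD2 Λ ω u * (u / (ω ^ 2 + u ^ 2))) +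
          uvWeightFn Λ ω e * (2 * uvWeightFnD1 Λ ω u * ((ω ^ 2 - u ^ 2) / (ω ^ 2 + u ^ 2) ^ 2)) +
          uvWeightFn Λ ω e * (uvWeightFn Λ ω u * (2 * u * (u ^ 2 - 3 * ω ^ 2) / (ω ^ 2 + u ^ 2) ^ 3)) := by ring
    rw [Real.norm_eq_abs, hsplit]
    refine ((abs_add_le _ _).trans (add_le_add ((abs_add_le _ _).trans (add_le_add ((abs_add_le _ _).trans (add_le_add ha hb)) hc)) hd)).trans
      (le_of_eq ?_)
    simp only [hg, hC]
    field_simp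
    ring
  have hsg : Summable g := (summable_one_div_ppFreq_sq_add_sq hβ Λ).mul_left C
  have hgsum : ∑' n, g n = C * (β * Real.tanh (β * Λ / 2) / (4 * Λ)) := by
    simp only [hg]; rw [tsum_mul_left, tsum_one_div_ppFreq_sq_add_sq hβ hΛ.ne']
  have ht := tsum_of_norm_bounded hsg.hasSum hbd
  rw [Real.norm_eq_abs, hgsum] at ht
  have htanh : Real.tanh (β * Λ / 2) ≤ 1 := (Real.tanh_lt_one _).le
  have hC0 : 0 ≤ C := by positivity
  rw [abs_mul, abs_of_pos (by positivity : (0 : ℝ) < 2 / β)]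
  calc 2 / β * |∑' n : ℕ, uvWeightFn Λ (ppFreq β n) e *
        (uvWeightFnD2 Λ (ppFreq β n) u * (e / (ppFreq β n ^ 2 + e ^ 2) + u / (ppFreq β n ^ 2 + u ^ 2)) +
          2 * uvWeightFnD1 Λ (ppFreq β n) u * ((ppFreq β n ^ 2 - u ^ 2) / (ppFreq β n ^ 2 + u ^ 2) ^ 2) +
          uvWeightFn Λ (ppFreq β n) u * (2 * u * (u ^ 2 - 3 * ppFreq β n ^ 2) / (ppFreq β n ^ 2 + u ^ 2) ^ 3))|
      ≤ 2 / β * (C * (β * Real.tanh (β * Λ / 2) / (4 * Λ))) := mul_le_mul_of_nonneg_left ht (by positivity)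
    _ = C / (2 * Λ) * Real.tanh (β * Λ / 2) := by field_simp; ring
    _ ≤ C / (2 * Λ) * 1 := mul_le_mul_of_nonneg_left htanh (by positivity)
    _ = (16 * B₂ + 24 * B₁ + 30) / Λ ^ 2 := by rw [hC]; field_simp; ring

end Summit.HubbardSuperconductivity.HubbardSuperconductivity.Theorems.C4a

end
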